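import Summits.QuantumFields.BalabanUV.Beta.GAN24.WWordMixedBondZero

/-!
# `BalabanUV.Beta.GAN24.WWordRespSummable` — binder row G-an2-4 ∕ (CONV-C), W-slot CT-W, conservation law (C)∕(C)sym, step (L3b) of this lineage's note
# `HOME/b2b-balaban-gan24-formalise-leaf-04/g66/CSYM-LEVEL0-KERNEL-BLUEPRINT.md` §7, companion of `WWordMixedBondZero`: **THE TWO SECOND-RESPONSE WORDS OF THE
# FACE-WEIGHTED `K·W·K` WORD ARE SUMMABLE ALONG THE LATTICE BOND, SO THE `K·W·K` WORD OF THE DRESSED SOURCE IS HALF THEIR SUM — UNCONDITIONALLY**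

NOT IN PRINT; OUR BOOKKEEPING ([folklore] Fubini bookkeeping over TREE objects BY NAME: an2's `SecondOrderResponse` (`biLoc_vertexOfK_of_biLoc`, `biLoc_vertexOfM_of_biLoc`,
`vertexFamily_K2OfK`), `BalabanCompositeJets.biLoc_recenter`, `KernelWard.biLoc_add`, leaf-06's `KernelLegCharges.summable_exp_coarse`, this lineage's
`WWordMixedBondZero` (`biLoc_twoFace_weight`, `hasSum_twoFace_W2SymOfK_sub_resp(_dressedStep)`); G-an2-4 formalisation swarm, leaf prover `b2b-balaban-gan24-formalise-leaf-04`,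
gen 66).  HONEST FRAMING (cell contract, verbatim): «discharging `BetaPertH` makes Bałaban's UV stability UNCONDITIONAL — a real constructive-QFT result; it is NOT the
continuum limit and NOT the Clay problem.»  HONEST DEPENDENCY (verbatim): «continuum YM on T⁴ ⇐ BetaPertH ∧ nine spine estimates (0/9 proved); BetaPertH ⇐ (D1) ∧ (D4) ∧
CAP+tail; G-an2-4 gates asym, D1 and NE2/3/4.»

WHY.  `WWordMixedBondZero.tsum_twoFace_W2SymOfK(_dressedStep)_eq_half_resp` takes the bond-summability of the two second-response words `u′ ↦ FFρ[dM (K2OfK K N S M κ′ u′) N S M κ u]`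
(INNER bond summed) and `u′ ↦ FFρ[dM (K2OfK K N S M κ u) N S M κ′ u′]` (OUTER bond summed) as hypotheses.  Both hold for every decaying `K` and localised tables: the derivative
of the inverse `K2OfK K N S M ν y′` is a vertex family (`vertexFamily_K2OfK`), and both chain-rule halves of `dM (K2 ν y′) N S M μ y` are bi-localised at `N•y′` with constants
decaying in the bond separation `|N•y − N•y′|₁` (`biLoc_vertexOfK_of_biLoc`, `biLoc_vertexOfM_of_biLoc`) — for the outer-summed word this is a centre-tied family at once, for
the inner-summed word after re-centring both legs to the fixed bond at half the rate (`biLoc_recenter`); a centre-tied family of bi-localised kernels has an absolutely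
convergent `(u′, (y, w))` family, whose `u′`-fibre sums are the pair sums (`Summable.prod`).

WHAT ([folklore]; generic `d`; 0 `def`, 0 cited facts, 0 `def … : Prop`, 0 sorry; weights `|ρ₁|, |ρ₂| ≤ 1`; legs `f g`): §1 `biLoc_of_le_const`, **`summable_tsum_prod_of_centreTied`**
(`Summable (u′ ↦ Σ'_{(y,w)} V u′ y w f g)` for `BiLoc (V u′) c c (Cv·e^{−δ|N•u′ − c|₁}) δ`), `exists_biLoc_resp_sep` (the second-response piece `dM (K2 ν y′) N S M μ y` is bi-localised at
`N•y′` with a constant `Cr·e^{−m|N•y − N•y′|₁}`), `exists_biLoc_resp_inner_centreTied` (re-centred to the outer bond); §2 GENERIC block `N`, `Decays K C m`, `LocStencil S Cs m`,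
`VertexFamily M N CM m`: **`summable_twoFace_resp_inner_bond`**, **`summable_twoFace_resp_outer_bond`**, **`tsum_twoFace_W2SymOfK_eq_half_resp'`** (the `tsum` identity of
`WWordMixedBondZero` with its two summability hypotheses DISCHARGED); `twoFace_resp_translate`, **`tsum_twoFace_resp_inner_eq_outer`** (block-covariant `K S M`: the
inner-summed response word is the outer-summed one with the bonds' roles exchanged — `ExchangeSlotResum.tsum_eq_tsum_of_cov`); **`summable_twoFace_W2SymOfK_bond`**; §3 DRESSED `X̃♮_j` (in-block root, `1 ≤ Lc`, every `j`, all units, ANY `LocStencil` `S`, `VertexFamily` `M`,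
jointly covariant `LocStencilFM` `M₂`, positive rates, bounded `Lc`-periodic weights): **`summable_twoFace_resp_inner_dressedStep_bond`**, **`summable_twoFace_resp_outer_dressedStep_bond`**,
**`tsum_twoFace_W2SymOfK_dressedStep_eq_half_resp'`**, **`summable_twoFace_W2SymOfK_dressedStep_bond`** (the third summability hypothesis of 21's
`zmode_dressedSource_inl_inl_of_summable`), and the cell-summed literal form **`sum_box_tsum_W_word_eq_half_resp`** (exit-face indicator weights, legs `inl α, inl β`: the
third word of `DressedSourceZeroModeWords.zmode_dressedSource_inl_inl_of_summable` with `W = W2SymOfK X̃♮_j Lc S M 0 M₂`) and, for block-covariant `S M`, the OUTER-SUMMED form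
**`sum_box_tsum_W_word_eq_half_outer_resp`** (`= ½·Σ_{c∈box P}(Σ'_{u′} FF[dM (K2OfK X̃♮_j … ν c) … μ u′] + Σ'_{u′} FF[dM (K2OfK X̃♮_j … μ c) … ν u′])`).  Asserts NO value of Bałaban's tables; discharges NOTHING
of (C)sym ∕ (Q-D) ∕ (Q-D-rate) ∕ «T2Shape» ∕ «T2Drift» ∕ (hW, hWall); NEVER «G-an2-4 closed» as (CONV-C); NOT D1, NOT `BetaPertH`, NOT continuum, NOT Clay.  2026-08-23; no existing
file touched.
-/

noncomputable section

open Finset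
open scoped BigOperators
open Literature.MathematicalPhysics.QuantumFieldTheory
open Literature.MathematicalPhysics.QuantumFieldTheory.Balaban1983to89
open Literature.MathematicalPhysics.QuantumFieldTheory.Balaban1983to89.Beta
open AffineAveraging (Site box toSite)
open B12Sec2to5 (l1 l1_nonneg)
open ExpKernelCalculus (MKer Decays BiLoc VertexFamily shiftK Zl l1_sub_symm summable_exp_shift')
open OneStepResolventKernel (Fib LocStencil biLoc_mono decays_mono)
open OneStepKernelFamily (KInvStep vertexOfK decays_KInvStep)
open BalabanStepJets (locStencil_mono)
open BalabanCompositeJets (biLoc_recenter)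
open KernelWard (biLoc_add)
open SecondOrderResponse (colM dM K2OfK vertexOfM mixOfK W2SymOfK LocStencilFM vertexFamily_K2OfK biLoc_vertexOfK_of_biLoc biLoc_vertexOfM_of_biLoc
  dM_shiftK_translate K2OfK_translate)
open Summit.QuantumFields.BalabanUV.Beta.HessKerDressedUnits (unitK decays_unitK)
open Summit.QuantumFields.BalabanUV.Beta.AxialDressingRooted (coDressKBmAt decays_coDressKBmAt)
open Summit.QuantumFields.BalabanUV.Beta.GAN24.KernelLegCharges (summable_exp_coarse)
open Summit.QuantumFields.BalabanUV.Beta.GAN24.ExchangeSlotResum (face_weight_periodic tsum_twoFace_shiftK tsum_eq_tsum_of_cov)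
open Summit.QuantumFields.BalabanUV.Beta.GAN24.EEWordReduced (shiftK_dressedStep)
open Summit.QuantumFields.BalabanUV.Beta.GAN24.DressedMultiplierVertexZero (hasSum_colM_dressedStep)
open Summit.QuantumFields.BalabanUV.Beta.GAN24.WWordMixedBondZero (biLoc_twoFace_weight tsum_twoFace_W2SymOfK_eq_half_resp hasSum_twoFace_W2SymOfK_sub_resp
  hasSum_twoFace_W2SymOfK_sub_resp_dressedStep)

namespace Summit.QuantumFields.BalabanUV.Beta.GAN24.WWordRespSummable

variable {d : ℕ}

/-! ## §1 Centre-tied families are bond-summable; the second-response piece is centre-tied -/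

section CentreTied

variable {N : ℕ} [NeZero N]

omit [NeZero N] in
/-- [folklore] A `BiLoc` bound survives enlarging the constant. -/
theorem biLoc_of_le_const {V : MKer (d + 1) (Fib d)} {p q : Site (d + 1)} {C C' δ : ℝ} (hV : BiLoc V p q C δ) (hC : C ≤ C') : BiLoc V p q C' δ :=
  fun x z a b => (hV x z a b).trans (mul_le_mul_of_nonneg_right hC (Real.exp_pos _).le)

/-- [folklore] **A CENTRE-TIED FAMILY OF BI-LOCALISED KERNELS HAS BOND-SUMMABLE PAIR SUMS**: if every `V u′` is bi-localised at one centre `c` (rate `δ > 0`) with a constant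
`Cv·e^{−δ|N•u′ − c|₁}`, then `u′ ↦ Σ'_{(y,w)} V u′ y w f g` is summable (the `(u′, (y, w))` family converges absolutely; `Summable.prod`). -/
theorem summable_tsum_prod_of_centreTied {V : Site (d + 1) → MKer (d + 1) (Fib d)} {Cv δv : ℝ} {c : Site (d + 1)} (hδv : 0 < δv)
    (hVb : ∀ u', BiLoc (V u') c c (Cv * Real.exp (-δv * l1 ((N : ℤ) • u' - c))) δv) (f g : Fib d) :
    Summable fun u' : Site (d + 1) => ∑' yw : Site (d + 1) × Site (d + 1), V u' yw.1 yw.2 f g := by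
  have hN : 1 ≤ N := Nat.one_le_iff_ne_zero.2 (NeZero.ne N)
  set G : Site (d + 1) × (Site (d + 1) × Site (d + 1)) → ℝ := fun q => V q.1 q.2.1 q.2.2 f g with hG
  have hGle : ∀ q, |G q| ≤ Cv * (Real.exp (-δv * l1 ((N : ℤ) • q.1 - c)) *
      (Real.exp (-δv * l1 (q.2.1 - c)) * Real.exp (-δv * l1 (q.2.2 - c)))) := by
    intro q
    have h := hVb q.1 q.2.1 q.2.2 f g
    rw [mul_add, Real.exp_add, mul_assoc] at h
    exact h
  have hmaj : Summable fun q : Site (d + 1) × (Site (d + 1) × Site (d + 1)) =>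
      Cv * (Real.exp (-δv * l1 ((N : ℤ) • q.1 - c)) *
        (Real.exp (-δv * l1 (q.2.1 - c)) * Real.exp (-δv * l1 (q.2.2 - c)))) := by
    have h1 := summable_exp_coarse (d := d) hN hδv c
    have h2 := summable_exp_shift' (D := d + 1) hδv c
    have h23 := h2.mul_of_nonneg h2 (fun _ => (Real.exp_pos _).le) (fun _ => (Real.exp_pos _).le)
    exact (h1.mul_of_nonneg h23 (fun _ => (Real.exp_pos _).le)
      (fun _ => mul_nonneg (Real.exp_pos _).le (Real.exp_pos _).le)).mul_left Cv
  have hGs : Summable G := Summable.of_norm_bounded hmaj (fun q => by rw [Real.norm_eq_abs]; exact hGle q)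
  have h3 := hGs.hasSum.prod_fiberwise fun u' => (hGs.prod_factor u').hasSum
  exact h3.summable

variable {S M : Fin (d + 1) → Site (d + 1) → MKer (d + 1) (Fib d)} {Cs CM : ℝ}

/-- [folklore] **THE SECOND-RESPONSE PIECE IS BI-LOCALISED AT THE INNER BOND WITH A CONSTANT DECAYING IN THE BOND SEPARATION**: for a vertex family `K2` (rate `m > 0`) and
tables `S` (`LocStencil`), `M` (`VertexFamily`) at rate `m`, there is `Cr ≥ 0` with `BiLoc (dM (K2 ν y′) N S M μ y) (N•y′) (N•y′) (Cr·e^{−m|N•y − N•y′|₁}) (m/2)` for all bond pairs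
(`biLoc_vertexOfK_of_biLoc` + `biLoc_vertexOfM_of_biLoc`; the un-recentred form of an2's `vertexFamily₂_resp`). -/
theorem exists_biLoc_resp_sep {K2 : Fin (d + 1) → Site (d + 1) → MKer (d + 1) (Fib d)} {C₂ m : ℝ} (hK2 : VertexFamily K2 N C₂ m)
    (hS : LocStencil S Cs m) (hM : VertexFamily M N CM m) (hm : 0 < m) :
    ∃ Cr : ℝ, 0 ≤ Cr ∧ ∀ (μ : Fin (d + 1)) (y : Site (d + 1)) (ν : Fin (d + 1)) (y' : Site (d + 1)),
      BiLoc (dM (K2 ν y') N S M μ y) ((N : ℤ) • y') ((N : ℤ) • y') (Cr * Real.exp (-m * l1 ((N : ℤ) • y - (N : ℤ) • y'))) (m / 2) := by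
  have hC₂ : 0 ≤ C₂ := (hK2 0 0).nonneg (Sum.inl 0)
  have hCs : 0 ≤ Cs := (hS 0 0).nonneg (Sum.inl 0)
  have hCM : 0 ≤ CM := (hM 0 0).nonneg (Sum.inl 0)
  have hZ := ExpKernelCalculus.Zl_nonneg (D := d + 1) (half_pos hm)
  refine ⟨(d + 1 : ℕ) * (C₂ * Cs * Zl (d + 1) (m / 2)) + (d + 1 : ℕ) * (C₂ * CM * Zl (d + 1) (m / 2)), by positivity, fun μ y ν y' => ?_⟩
  have h := biLoc_add (biLoc_vertexOfK_of_biLoc (N := N) (hK2 ν y') hS hm μ y) (biLoc_vertexOfM_of_biLoc (N := N) (hK2 ν y') hM hm μ y)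
  have e : (d + 1 : ℕ) * (C₂ * Real.exp (-m * l1 ((N : ℤ) • y - (N : ℤ) • y')) * Cs * Zl (d + 1) (m / 2))
      + (d + 1 : ℕ) * (C₂ * Real.exp (-m * l1 ((N : ℤ) • y - (N : ℤ) • y')) * CM * Zl (d + 1) (m / 2))
      = ((d + 1 : ℕ) * (C₂ * Cs * Zl (d + 1) (m / 2)) + (d + 1 : ℕ) * (C₂ * CM * Zl (d + 1) (m / 2)))
        * Real.exp (-m * l1 ((N : ℤ) • y - (N : ℤ) • y')) := by ring
  rw [e] at h
  exact h

/-- [folklore] **THE INNER-SUMMED SECOND-RESPONSE PIECE, RE-CENTRED TO THE OUTER BOND**: there is `Cr ≥ 0` with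
`BiLoc (dM (K2 κ′ u′) N S M κ u) (N•u) (N•u) (Cr·e^{−(m/4)|N•u′ − N•u|₁}) (m/4)` for all bond pairs (rate halved to `m/4`, both legs re-centred from `N•u′` to `N•u` at the cost
`e^{(m/2)|N•u′ − N•u|₁}` — `biLoc_recenter` — paid by the separation decay; the surviving `e^{−(m/2)|·|₁}` weakened to the rate). -/
theorem exists_biLoc_resp_inner_centreTied {K2 : Fin (d + 1) → Site (d + 1) → MKer (d + 1) (Fib d)} {C₂ m : ℝ} (hK2 : VertexFamily K2 N C₂ m)
    (hS : LocStencil S Cs m) (hM : VertexFamily M N CM m) (hm : 0 < m) :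
    ∃ Cr : ℝ, 0 ≤ Cr ∧ ∀ (κ : Fin (d + 1)) (u : Site (d + 1)) (κ' : Fin (d + 1)) (u' : Site (d + 1)),
      BiLoc (dM (K2 κ' u') N S M κ u) ((N : ℤ) • u) ((N : ℤ) • u) (Cr * Real.exp (-(m / 4) * l1 ((N : ℤ) • u' - (N : ℤ) • u))) (m / 4) := by
  obtain ⟨Cr, hCr, hsep⟩ := exists_biLoc_resp_sep hK2 hS hM hm
  refine ⟨Cr, hCr, fun κ u κ' u' => ?_⟩
  have h := hsep κ u κ' u'
  have h4 : BiLoc (dM (K2 κ' u') N S M κ u) ((N : ℤ) • u') ((N : ℤ) • u') (Cr * Real.exp (-m * l1 ((N : ℤ) • u - (N : ℤ) • u'))) (m / 4) :=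
    biLoc_mono h (by positivity) (by linarith)
  have h5 := biLoc_recenter h4 (by positivity : (0 : ℝ) ≤ m / 4) ((N : ℤ) • u)
  refine biLoc_of_le_const h5 ?_
  rw [l1_sub_symm ((N : ℤ) • u) ((N : ℤ) • u'), mul_assoc, ← Real.exp_add]
  refine mul_le_mul_of_nonneg_left (Real.exp_le_exp.2 ?_) hCr
  have hl := l1_nonneg ((N : ℤ) • u' - (N : ℤ) • u)
  nlinarith

end CentreTied

/-! ## §2 Generic block: the two second-response words are bond-summable; the unconditional `tsum` identity -/

section Generic

variable {N : ℕ} [NeZero N] {ρ₁ ρ₂ : Site (d + 1) → ℝ} {K : MKer (d + 1) (Fib d)} {C m : ℝ}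
  {M₂ : Fin (d + 1) → Site (d + 1) → Fin (d + 1) → Site (d + 1) → MKer (d + 1) (Fib d)} {C₂ : ℝ}
  {S M : Fin (d + 1) → Site (d + 1) → MKer (d + 1) (Fib d)} {Cs CM : ℝ}

/-- [folklore] **THE INNER-SUMMED SECOND-RESPONSE WORD IS BOND-SUMMABLE**: `Summable (u′ ↦ Σ'_{(y,w)} ρ₁(y)ρ₂(w)·dM (K2OfK K N S M κ′ u′) N S M κ u y w f g)`. -/
theorem summable_twoFace_resp_inner_bond (hK : Decays K C m) (hm : 0 < m) (hS : LocStencil S Cs m) (hM : VertexFamily M N CM m)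
    (h₁ : ∀ y, |ρ₁ y| ≤ 1) (h₂ : ∀ w, |ρ₂ w| ≤ 1) (κ : Fin (d + 1)) (u : Site (d + 1)) (κ' : Fin (d + 1)) (f g : Fib d) :
    Summable fun u' : Site (d + 1) => ∑' yw : Site (d + 1) × Site (d + 1), ρ₁ yw.1 * ρ₂ yw.2 * dM (K2OfK K N S M κ' u') N S M κ u yw.1 yw.2 f g := by
  have hC : 0 ≤ C := hK.nonneg (Sum.inl 0)
  have hCs : 0 ≤ Cs := (hS 0 0).nonneg (Sum.inl 0)
  have hCM : 0 ≤ CM := (hM 0 0).nonneg (Sum.inl 0)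
  have hm8 : 0 < m / 8 := by positivity
  have hK2 := vertexFamily_K2OfK (N := N) hK hC hm hS hM
  have hS8 : LocStencil S Cs (m / 8) := locStencil_mono hS hCs (by linarith)
  have hM8 : VertexFamily M N CM (m / 8) := fun μ y => biLoc_mono (hM μ y) hCM (by linarith)
  obtain ⟨Cr, -, hc⟩ := exists_biLoc_resp_inner_centreTied hK2 hS8 hM8 hm8
  have hVb : ∀ u' : Site (d + 1), BiLoc (fun y w a b => ρ₁ y * ρ₂ w * dM (K2OfK K N S M κ' u') N S M κ u y w a b) ((N : ℤ) • u) ((N : ℤ) • u)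
      (Cr * Real.exp (-(m / 8 / 4) * l1 ((N : ℤ) • u' - (N : ℤ) • u))) (m / 8 / 4) :=
    fun u' => biLoc_twoFace_weight (hc κ u κ' u') h₁ h₂
  exact summable_tsum_prod_of_centreTied (V := fun u' => fun y w a b => ρ₁ y * ρ₂ w * dM (K2OfK K N S M κ' u') N S M κ u y w a b)
    (by positivity) hVb f g

/-- [folklore] **THE OUTER-SUMMED SECOND-RESPONSE WORD IS BOND-SUMMABLE**: `Summable (u′ ↦ Σ'_{(y,w)} ρ₁(y)ρ₂(w)·dM (K2OfK K N S M κ u) N S M κ′ u′ y w f g)`. -/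
theorem summable_twoFace_resp_outer_bond (hK : Decays K C m) (hm : 0 < m) (hS : LocStencil S Cs m) (hM : VertexFamily M N CM m)
    (h₁ : ∀ y, |ρ₁ y| ≤ 1) (h₂ : ∀ w, |ρ₂ w| ≤ 1) (κ : Fin (d + 1)) (u : Site (d + 1)) (κ' : Fin (d + 1)) (f g : Fib d) :
    Summable fun u' : Site (d + 1) => ∑' yw : Site (d + 1) × Site (d + 1), ρ₁ yw.1 * ρ₂ yw.2 * dM (K2OfK K N S M κ u) N S M κ' u' yw.1 yw.2 f g := by
  have hC : 0 ≤ C := hK.nonneg (Sum.inl 0)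
  have hCs : 0 ≤ Cs := (hS 0 0).nonneg (Sum.inl 0)
  have hCM : 0 ≤ CM := (hM 0 0).nonneg (Sum.inl 0)
  have hm8 : 0 < m / 8 := by positivity
  have hK2 := vertexFamily_K2OfK (N := N) hK hC hm hS hM
  have hS8 : LocStencil S Cs (m / 8) := locStencil_mono hS hCs (by linarith)
  have hM8 : VertexFamily M N CM (m / 8) := fun μ y => biLoc_mono (hM μ y) hCM (by linarith)
  obtain ⟨Cr, hCr, hsep⟩ := exists_biLoc_resp_sep hK2 hS8 hM8 hm8
  have hVb : ∀ u' : Site (d + 1), BiLoc (fun y w a b => ρ₁ y * ρ₂ w * dM (K2OfK K N S M κ u) N S M κ' u' y w a b) ((N : ℤ) • u) ((N : ℤ) • u)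
      (Cr * Real.exp (-(m / 8 / 2) * l1 ((N : ℤ) • u' - (N : ℤ) • u))) (m / 8 / 2) := by
    intro u'
    have h := hsep κ' u' κ u
    refine biLoc_twoFace_weight (biLoc_of_le_const h ?_) h₁ h₂
    refine mul_le_mul_of_nonneg_left (Real.exp_le_exp.2 ?_) hCr
    have hl := l1_nonneg ((N : ℤ) • u' - (N : ℤ) • u)
    nlinarith
  exact summable_tsum_prod_of_centreTied (V := fun u' => fun y w a b => ρ₁ y * ρ₂ w * dM (K2OfK K N S M κ u) N S M κ' u' y w a b)
    (by positivity) hVb f g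

/-- [folklore] **THE FACE-WEIGHTED `W`-WORD, SUMMED ALONG THE BOND, IS HALF THE SUM OF THE TWO SECOND-RESPONSE WORDS — `tsum` identity, no summability hypothesis**:
`Σ'_{u′} FFρ[W2SymOfK K N S M 0 M₂ κ u κ′ u′] = ½·(Σ'_{u′} FFρ[dM (K2OfK K N S M κ′ u′) N S M κ u] + Σ'_{u′} FFρ[dM (K2OfK K N S M κ u) N S M κ′ u′])`. -/
theorem tsum_twoFace_W2SymOfK_eq_half_resp' (hK : Decays K C m) (hm : 0 < m) (hKs : ∀ t, shiftK (-((N : ℤ) • t)) K = K)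
    (hK0 : ∀ μ ρ w, HasSum (fun y : Site (d + 1) => colM K N μ y ρ w) 0)
    (hS : LocStencil S Cs m) (hM : VertexFamily M N CM m) (hM₂ : LocStencilFM N M₂ C₂ m)
    (hM₂t : ∀ (κ : Fin (d + 1)) (u : Site (d + 1)) (ρ : Fin (d + 1)) (w t : Site (d + 1)),
      M₂ κ (u + (N : ℤ) • t) ρ (w + t) = shiftK (-((N : ℤ) • t)) (M₂ κ u ρ w))
    (h₁ : ∀ y, |ρ₁ y| ≤ 1) (h₂ : ∀ w, |ρ₂ w| ≤ 1)
    (hρ₁ : ∀ y s : Site (d + 1), ρ₁ (y + (N : ℤ) • s) = ρ₁ y) (hρ₂ : ∀ w s : Site (d + 1), ρ₂ (w + (N : ℤ) • s) = ρ₂ w)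
    (κ : Fin (d + 1)) (u : Site (d + 1)) (κ' : Fin (d + 1)) (f g : Fib d) :
    (∑' u' : Site (d + 1), ∑' yw : Site (d + 1) × Site (d + 1), ρ₁ yw.1 * ρ₂ yw.2 * W2SymOfK K N S M 0 M₂ κ u κ' u' yw.1 yw.2 f g)
      = (1 / 2 : ℝ) * ((∑' u' : Site (d + 1), ∑' yw : Site (d + 1) × Site (d + 1), ρ₁ yw.1 * ρ₂ yw.2 * dM (K2OfK K N S M κ' u') N S M κ u yw.1 yw.2 f g)
        + ∑' u' : Site (d + 1), ∑' yw : Site (d + 1) × Site (d + 1), ρ₁ yw.1 * ρ₂ yw.2 * dM (K2OfK K N S M κ u) N S M κ' u' yw.1 yw.2 f g) :=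
  tsum_twoFace_W2SymOfK_eq_half_resp hK hm hKs hK0 hS hM hM₂ hM₂t h₁ h₂ hρ₁ hρ₂ κ u κ' f g
    (summable_twoFace_resp_inner_bond hK hm hS hM h₁ h₂ κ u κ' f g) (summable_twoFace_resp_outer_bond hK hm hS hM h₁ h₂ κ u κ' f g)


/-- [folklore] **JOINT TRANSLATION INVARIANCE OF THE WEIGHTED SECOND-RESPONSE WORD** (block-covariant `K`, block-covariant first tables, `N`-periodic weights):
`FFρ[dM (K2OfK K N S M κ′ (a + t)) N S M κ (b + t)] = FFρ[dM (K2OfK K N S M κ′ a) N S M κ b]` (`K2OfK_translate` ⨾ `dM_shiftK_translate` ⨾ `tsum_twoFace_shiftK`). -/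
theorem twoFace_resp_translate (hKs : ∀ t, shiftK (-((N : ℤ) • t)) K = K)
    (hSt : ∀ (κ : Fin (d + 1)) (u t : Site (d + 1)), S κ (u + (N : ℤ) • t) = shiftK (-((N : ℤ) • t)) (S κ u))
    (hMt : ∀ (ρ : Fin (d + 1)) (w t : Site (d + 1)), M ρ (w + t) = shiftK (-((N : ℤ) • t)) (M ρ w))
    (hρ₁ : ∀ y s : Site (d + 1), ρ₁ (y + (N : ℤ) • s) = ρ₁ y) (hρ₂ : ∀ w s : Site (d + 1), ρ₂ (w + (N : ℤ) • s) = ρ₂ w)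
    (κ κ' : Fin (d + 1)) (a b t : Site (d + 1)) (f g : Fib d) :
    (∑' yw : Site (d + 1) × Site (d + 1), ρ₁ yw.1 * ρ₂ yw.2 * dM (K2OfK K N S M κ' (a + t)) N S M κ (b + t) yw.1 yw.2 f g)
      = ∑' yw : Site (d + 1) × Site (d + 1), ρ₁ yw.1 * ρ₂ yw.2 * dM (K2OfK K N S M κ' a) N S M κ b yw.1 yw.2 f g := by
  rw [K2OfK_translate hKs hSt hMt κ' a t, dM_shiftK_translate (K2OfK K N S M κ' a) hSt hMt κ b t]
  exact tsum_twoFace_shiftK hρ₁ hρ₂ _ t f g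

/-- [folklore] **THE INNER-SUMMED SECOND-RESPONSE WORD IS AN OUTER-SUMMED ONE** (joint covariance moves the lattice sum across the two bonds,
`ExchangeSlotResum.tsum_eq_tsum_of_cov`): `Σ'_{u′} FFρ[dM (K2OfK K N S M κ′ u′) N S M κ u] = Σ'_{u′} FFρ[dM (K2OfK K N S M κ′ u) N S M κ u′]`. -/
theorem tsum_twoFace_resp_inner_eq_outer (hKs : ∀ t, shiftK (-((N : ℤ) • t)) K = K)
    (hSt : ∀ (κ : Fin (d + 1)) (u t : Site (d + 1)), S κ (u + (N : ℤ) • t) = shiftK (-((N : ℤ) • t)) (S κ u))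
    (hMt : ∀ (ρ : Fin (d + 1)) (w t : Site (d + 1)), M ρ (w + t) = shiftK (-((N : ℤ) • t)) (M ρ w))
    (hρ₁ : ∀ y s : Site (d + 1), ρ₁ (y + (N : ℤ) • s) = ρ₁ y) (hρ₂ : ∀ w s : Site (d + 1), ρ₂ (w + (N : ℤ) • s) = ρ₂ w)
    (κ : Fin (d + 1)) (u : Site (d + 1)) (κ' : Fin (d + 1)) (f g : Fib d) :
    (∑' u' : Site (d + 1), ∑' yw : Site (d + 1) × Site (d + 1), ρ₁ yw.1 * ρ₂ yw.2 * dM (K2OfK K N S M κ' u') N S M κ u yw.1 yw.2 f g)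
      = ∑' u' : Site (d + 1), ∑' yw : Site (d + 1) × Site (d + 1), ρ₁ yw.1 * ρ₂ yw.2 * dM (K2OfK K N S M κ' u) N S M κ u' yw.1 yw.2 f g :=
  tsum_eq_tsum_of_cov (G := fun a b => ∑' yw : Site (d + 1) × Site (d + 1), ρ₁ yw.1 * ρ₂ yw.2 * dM (K2OfK K N S M κ' a) N S M κ b yw.1 yw.2 f g)
    (fun a b t => twoFace_resp_translate hKs hSt hMt hρ₁ hρ₂ κ κ' a b t f g) u


/-- [folklore] **THE FACE-WEIGHTED `W`-WORD IS BOND-SUMMABLE** (`W = (W − ½(R₁+R₂)) + ½(R₁+R₂)`: `WWordMixedBondZero.hasSum_twoFace_W2SymOfK_sub_resp` + §2). -/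
theorem summable_twoFace_W2SymOfK_bond (hK : Decays K C m) (hm : 0 < m) (hKs : ∀ t, shiftK (-((N : ℤ) • t)) K = K)
    (hK0 : ∀ μ ρ w, HasSum (fun y : Site (d + 1) => colM K N μ y ρ w) 0)
    (hS : LocStencil S Cs m) (hM : VertexFamily M N CM m) (hM₂ : LocStencilFM N M₂ C₂ m)
    (hM₂t : ∀ (κ : Fin (d + 1)) (u : Site (d + 1)) (ρ : Fin (d + 1)) (w t : Site (d + 1)),
      M₂ κ (u + (N : ℤ) • t) ρ (w + t) = shiftK (-((N : ℤ) • t)) (M₂ κ u ρ w))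
    (h₁ : ∀ y, |ρ₁ y| ≤ 1) (h₂ : ∀ w, |ρ₂ w| ≤ 1)
    (hρ₁ : ∀ y s : Site (d + 1), ρ₁ (y + (N : ℤ) • s) = ρ₁ y) (hρ₂ : ∀ w s : Site (d + 1), ρ₂ (w + (N : ℤ) • s) = ρ₂ w)
    (κ : Fin (d + 1)) (u : Site (d + 1)) (κ' : Fin (d + 1)) (f g : Fib d) :
    Summable fun u' : Site (d + 1) => ∑' yw : Site (d + 1) × Site (d + 1), ρ₁ yw.1 * ρ₂ yw.2 * W2SymOfK K N S M 0 M₂ κ u κ' u' yw.1 yw.2 f g := by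
  have h0 := hasSum_twoFace_W2SymOfK_sub_resp hK hm hKs hK0 hS hM hM₂ hM₂t h₁ h₂ hρ₁ hρ₂ κ u κ' f g
  have hR := ((summable_twoFace_resp_inner_bond hK hm hS hM h₁ h₂ κ u κ' f g).add
    (summable_twoFace_resp_outer_bond hK hm hS hM h₁ h₂ κ u κ' f g)).mul_left (1 / 2 : ℝ)
  have h := h0.summable.add hR
  simp only [sub_add_cancel] at h
  exact h

end Generic

/-! ## §3 The dressed instances -/

section Dressed

variable {Lc : ℕ} [NeZero Lc] {r : Fin (d + 1) → ℕ} {ρ₁ ρ₂ : Site (d + 1) → ℝ}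
  {M₂ : Fin (d + 1) → Site (d + 1) → Fin (d + 1) → Site (d + 1) → MKer (d + 1) (Fib d)} {C₂ δ₂ : ℝ}
  {S M : Fin (d + 1) → Site (d + 1) → MKer (d + 1) (Fib d)} {Cs δs CM δM : ℝ}

/-- [folklore] Common decay data for the dressed kernel and two first tables at positive rates. -/
theorem exists_resp_data (hLc : 1 ≤ Lc) (hr : r ∈ box (d + 1) Lc) (sf sm : ℝ) (j : ℕ)
    (hS : LocStencil S Cs δs) (hδs : 0 < δs) (hM : VertexFamily M Lc CM δM) (hδM : 0 < δM) :
    ∃ C m : ℝ, 0 < m ∧ Decays (unitK sf sm (coDressKBmAt (toSite r) Lc (KInvStep (d := d) Lc j))) C m ∧ LocStencil S Cs m ∧ VertexFamily M Lc CM m := by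
  obtain ⟨δ, C, hδ, hC, hXd⟩ := decays_coDressKBmAt hLc hr (decays_KInvStep (d := d) (Lc := Lc) j)
  have hXu := decays_unitK (sf := sf) (sm := sm) hXd
  have hCs : 0 ≤ Cs := (hS 0 0).nonneg (Sum.inl 0)
  have hCM : 0 ≤ CM := (hM 0 0).nonneg (Sum.inl 0)
  set m : ℝ := min (min δ δs) δM with hm_def
  have hm : 0 < m := lt_min (lt_min hδ hδs) hδM
  have hmM : m ≤ δM := min_le_right _ _
  have hms : m ≤ δs := (min_le_left _ _).trans (min_le_right _ _)
  have hmK : m ≤ δ := (min_le_left _ _).trans (min_le_left _ _)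
  exact ⟨_, m, hm, decays_mono hXu (by positivity) le_rfl hmK, locStencil_mono hS hCs hms, fun μ y => biLoc_mono (hM μ y) hCM hmM⟩

/-- [folklore] **THE INNER-SUMMED SECOND-RESPONSE WORD OF THE DRESSED SOURCE IS BOND-SUMMABLE** (in-block root, `1 ≤ Lc`, every `j`, all units, ANY `LocStencil` `S`,
`VertexFamily` `M` at positive rates, bounded weights, every bond pair of axes, every outer bond, every fibre pair). -/
theorem summable_twoFace_resp_inner_dressedStep_bond (hLc : 1 ≤ Lc) (hr : r ∈ box (d + 1) Lc) (sf sm : ℝ) (j : ℕ)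
    (hS : LocStencil S Cs δs) (hδs : 0 < δs) (hM : VertexFamily M Lc CM δM) (hδM : 0 < δM) (h₁ : ∀ y, |ρ₁ y| ≤ 1) (h₂ : ∀ w, |ρ₂ w| ≤ 1)
    (κ : Fin (d + 1)) (u : Site (d + 1)) (κ' : Fin (d + 1)) (f g : Fib d) :
    Summable fun u' : Site (d + 1) => ∑' yw : Site (d + 1) × Site (d + 1), ρ₁ yw.1 * ρ₂ yw.2 *
      dM (K2OfK (unitK sf sm (coDressKBmAt (toSite r) Lc (KInvStep (d := d) Lc j))) Lc S M κ' u') Lc S M κ u yw.1 yw.2 f g := by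
  obtain ⟨C, m, hm, hX, hS', hM'⟩ := exists_resp_data hLc hr sf sm j hS hδs hM hδM
  exact summable_twoFace_resp_inner_bond hX hm hS' hM' h₁ h₂ κ u κ' f g

/-- [folklore] **THE OUTER-SUMMED SECOND-RESPONSE WORD OF THE DRESSED SOURCE IS BOND-SUMMABLE.** -/
theorem summable_twoFace_resp_outer_dressedStep_bond (hLc : 1 ≤ Lc) (hr : r ∈ box (d + 1) Lc) (sf sm : ℝ) (j : ℕ)
    (hS : LocStencil S Cs δs) (hδs : 0 < δs) (hM : VertexFamily M Lc CM δM) (hδM : 0 < δM) (h₁ : ∀ y, |ρ₁ y| ≤ 1) (h₂ : ∀ w, |ρ₂ w| ≤ 1)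
    (κ : Fin (d + 1)) (u : Site (d + 1)) (κ' : Fin (d + 1)) (f g : Fib d) :
    Summable fun u' : Site (d + 1) => ∑' yw : Site (d + 1) × Site (d + 1), ρ₁ yw.1 * ρ₂ yw.2 *
      dM (K2OfK (unitK sf sm (coDressKBmAt (toSite r) Lc (KInvStep (d := d) Lc j))) Lc S M κ u) Lc S M κ' u' yw.1 yw.2 f g := by
  obtain ⟨C, m, hm, hX, hS', hM'⟩ := exists_resp_data hLc hr sf sm j hS hδs hM hδM
  exact summable_twoFace_resp_outer_bond hX hm hS' hM' h₁ h₂ κ u κ' f g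

/-- [folklore] **THE `K·W·K` WORD OF THE DRESSED SOURCE, SUMMED ALONG THE LATTICE BOND, IS HALF THE SUM OF ITS TWO SECOND-RESPONSE WORDS — UNCONDITIONALLY** (in-block root,
`1 ≤ Lc`, every `j`, all units; ANY `LocStencil` `S`, `VertexFamily` `M`, jointly block-covariant `LocStencilFM` `M₂`, positive rates; bounded `Lc`-periodic weights; every first bond and
fibre pair): `Σ'_{u′} FFρ[W2SymOfK X̃♮_j Lc S M 0 M₂ κ u κ′ u′] = ½·(Σ'_{u′} FFρ[dM (K2OfK X̃♮_j Lc S M κ′ u′) Lc S M κ u] + Σ'_{u′} FFρ[dM (K2OfK X̃♮_j Lc S M κ u) Lc S M κ′ u′])`. -/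
theorem tsum_twoFace_W2SymOfK_dressedStep_eq_half_resp' (hLc : 1 ≤ Lc) (hr : r ∈ box (d + 1) Lc) (sf sm : ℝ) (j : ℕ)
    (hS : LocStencil S Cs δs) (hδs : 0 < δs) (hM : VertexFamily M Lc CM δM) (hδM : 0 < δM) (hM₂ : LocStencilFM Lc M₂ C₂ δ₂) (hδ₂ : 0 < δ₂)
    (hM₂t : ∀ (κ : Fin (d + 1)) (u : Site (d + 1)) (ρ : Fin (d + 1)) (w t : Site (d + 1)),
      M₂ κ (u + (Lc : ℤ) • t) ρ (w + t) = shiftK (-((Lc : ℤ) • t)) (M₂ κ u ρ w))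
    (h₁ : ∀ y, |ρ₁ y| ≤ 1) (h₂ : ∀ w, |ρ₂ w| ≤ 1)
    (hρ₁ : ∀ y s : Site (d + 1), ρ₁ (y + (Lc : ℤ) • s) = ρ₁ y) (hρ₂ : ∀ w s : Site (d + 1), ρ₂ (w + (Lc : ℤ) • s) = ρ₂ w)
    (κ : Fin (d + 1)) (u : Site (d + 1)) (κ' : Fin (d + 1)) (f g : Fib d) :
    (∑' u' : Site (d + 1), ∑' yw : Site (d + 1) × Site (d + 1), ρ₁ yw.1 * ρ₂ yw.2 *
        W2SymOfK (unitK sf sm (coDressKBmAt (toSite r) Lc (KInvStep (d := d) Lc j))) Lc S M 0 M₂ κ u κ' u' yw.1 yw.2 f g)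
      = (1 / 2 : ℝ) * ((∑' u' : Site (d + 1), ∑' yw : Site (d + 1) × Site (d + 1), ρ₁ yw.1 * ρ₂ yw.2 *
            dM (K2OfK (unitK sf sm (coDressKBmAt (toSite r) Lc (KInvStep (d := d) Lc j))) Lc S M κ' u') Lc S M κ u yw.1 yw.2 f g)
        + ∑' u' : Site (d + 1), ∑' yw : Site (d + 1) × Site (d + 1), ρ₁ yw.1 * ρ₂ yw.2 *
            dM (K2OfK (unitK sf sm (coDressKBmAt (toSite r) Lc (KInvStep (d := d) Lc j))) Lc S M κ u) Lc S M κ' u' yw.1 yw.2 f g) := by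
  have h0 := hasSum_twoFace_W2SymOfK_sub_resp_dressedStep hLc hr sf sm j hS hδs hM hδM hM₂ hδ₂ hM₂t h₁ h₂ hρ₁ hρ₂ κ u κ' f g
  have hR₁ := summable_twoFace_resp_inner_dressedStep_bond hLc hr sf sm j hS hδs hM hδM h₁ h₂ κ u κ' f g
  have hR₂ := summable_twoFace_resp_outer_dressedStep_bond hLc hr sf sm j hS hδs hM hδM h₁ h₂ κ u κ' f g
  have hR := (hR₁.add hR₂).mul_left (1 / 2 : ℝ)
  have h := h0.add hR.hasSum
  simp only [sub_add_cancel, zero_add] at h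
  rw [h.tsum_eq, tsum_mul_left, hR₁.tsum_add hR₂]

/-- [folklore] **THE FACE-WEIGHTED `W`-WORD OF THE DRESSED SOURCE IS BOND-SUMMABLE** — the third summability hypothesis of
`DressedSourceZeroModeWords.zmode_dressedSource_inl_inl_of_summable` for `W = W2SymOfK X̃♮_j Lc S M 0 M₂`. -/
theorem summable_twoFace_W2SymOfK_dressedStep_bond (hLc : 1 ≤ Lc) (hr : r ∈ box (d + 1) Lc) (sf sm : ℝ) (j : ℕ)
    (hS : LocStencil S Cs δs) (hδs : 0 < δs) (hM : VertexFamily M Lc CM δM) (hδM : 0 < δM) (hM₂ : LocStencilFM Lc M₂ C₂ δ₂) (hδ₂ : 0 < δ₂)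
    (hM₂t : ∀ (κ : Fin (d + 1)) (u : Site (d + 1)) (ρ : Fin (d + 1)) (w t : Site (d + 1)),
      M₂ κ (u + (Lc : ℤ) • t) ρ (w + t) = shiftK (-((Lc : ℤ) • t)) (M₂ κ u ρ w))
    (h₁ : ∀ y, |ρ₁ y| ≤ 1) (h₂ : ∀ w, |ρ₂ w| ≤ 1)
    (hρ₁ : ∀ y s : Site (d + 1), ρ₁ (y + (Lc : ℤ) • s) = ρ₁ y) (hρ₂ : ∀ w s : Site (d + 1), ρ₂ (w + (Lc : ℤ) • s) = ρ₂ w)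
    (κ : Fin (d + 1)) (u : Site (d + 1)) (κ' : Fin (d + 1)) (f g : Fib d) :
    Summable fun u' : Site (d + 1) => ∑' yw : Site (d + 1) × Site (d + 1), ρ₁ yw.1 * ρ₂ yw.2 *
      W2SymOfK (unitK sf sm (coDressKBmAt (toSite r) Lc (KInvStep (d := d) Lc j))) Lc S M 0 M₂ κ u κ' u' yw.1 yw.2 f g := by
  have h0 := hasSum_twoFace_W2SymOfK_sub_resp_dressedStep hLc hr sf sm j hS hδs hM hδM hM₂ hδ₂ hM₂t h₁ h₂ hρ₁ hρ₂ κ u κ' f g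
  have hR := ((summable_twoFace_resp_inner_dressedStep_bond hLc hr sf sm j hS hδs hM hδM h₁ h₂ κ u κ' f g).add
    (summable_twoFace_resp_outer_dressedStep_bond hLc hr sf sm j hS hδs hM hδM h₁ h₂ κ u κ' f g)).mul_left (1 / 2 : ℝ)
  have h := h0.summable.add hR
  simp only [sub_add_cancel] at h
  exact h

/-- [folklore] **THE CELL-AND-LATTICE SUM OF THE LITERAL `K·W·K` WORD OF `DressedSourceZeroModeWords`** (exit-face indicator weights on axes `α β`, legs `inl α, inl β`, any cell range
`P`): `Σ_{c∈box P} Σ'_{u′} FF[W2SymOfK X̃♮_j Lc S M 0 M₂ μ c ν u′] = ½·Σ_{c∈box P} (Σ'_{u′} FF[dM (K2OfK X̃♮_j … ν u′) … μ c] + Σ'_{u′} FF[dM (K2OfK X̃♮_j … μ c) … ν u′])`. -/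
theorem sum_box_tsum_W_word_eq_half_resp (hLc : 1 ≤ Lc) (hr : r ∈ box (d + 1) Lc) (sf sm : ℝ) (j : ℕ)
    (hS : LocStencil S Cs δs) (hδs : 0 < δs) (hM : VertexFamily M Lc CM δM) (hδM : 0 < δM) (hM₂ : LocStencilFM Lc M₂ C₂ δ₂) (hδ₂ : 0 < δ₂)
    (hM₂t : ∀ (κ : Fin (d + 1)) (u : Site (d + 1)) (ρ : Fin (d + 1)) (w t : Site (d + 1)),
      M₂ κ (u + (Lc : ℤ) • t) ρ (w + t) = shiftK (-((Lc : ℤ) • t)) (M₂ κ u ρ w))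
    (P : ℕ) (μ ν α β : Fin (d + 1)) :
    (∑ c ∈ box (d + 1) P, ∑' u' : Site (d + 1), ∑' yw : Site (d + 1) × Site (d + 1),
        (if yw.1 α % (Lc : ℤ) = (Lc : ℤ) - 1 then (1 : ℝ) else 0) * (if yw.2 β % (Lc : ℤ) = (Lc : ℤ) - 1 then (1 : ℝ) else 0) *
          W2SymOfK (unitK sf sm (coDressKBmAt (toSite r) Lc (KInvStep (d := d) Lc j))) Lc S M 0 M₂ μ (toSite c) ν u' yw.1 yw.2 (Sum.inl α) (Sum.inl β))
      = (1 / 2 : ℝ) * ∑ c ∈ box (d + 1) P,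
          ((∑' u' : Site (d + 1), ∑' yw : Site (d + 1) × Site (d + 1),
              (if yw.1 α % (Lc : ℤ) = (Lc : ℤ) - 1 then (1 : ℝ) else 0) * (if yw.2 β % (Lc : ℤ) = (Lc : ℤ) - 1 then (1 : ℝ) else 0) *
                dM (K2OfK (unitK sf sm (coDressKBmAt (toSite r) Lc (KInvStep (d := d) Lc j))) Lc S M ν u') Lc S M μ (toSite c) yw.1 yw.2 (Sum.inl α) (Sum.inl β))
            + ∑' u' : Site (d + 1), ∑' yw : Site (d + 1) × Site (d + 1),
              (if yw.1 α % (Lc : ℤ) = (Lc : ℤ) - 1 then (1 : ℝ) else 0) * (if yw.2 β % (Lc : ℤ) = (Lc : ℤ) - 1 then (1 : ℝ) else 0) *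
                dM (K2OfK (unitK sf sm (coDressKBmAt (toSite r) Lc (KInvStep (d := d) Lc j))) Lc S M μ (toSite c)) Lc S M ν u' yw.1 yw.2 (Sum.inl α) (Sum.inl β)) := by
  rw [Finset.mul_sum]
  refine Finset.sum_congr rfl fun c _ => ?_
  exact tsum_twoFace_W2SymOfK_dressedStep_eq_half_resp' hLc hr sf sm j hS hδs hM hδM hM₂ hδ₂ hM₂t
    (ρ₁ := fun y : Site (d + 1) => (if y α % (Lc : ℤ) = (Lc : ℤ) - 1 then (1 : ℝ) else 0))
    (ρ₂ := fun w : Site (d + 1) => (if w β % (Lc : ℤ) = (Lc : ℤ) - 1 then (1 : ℝ) else 0))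
    (fun y => by split_ifs <;> simp) (fun w => by split_ifs <;> simp)
    (fun y s => face_weight_periodic Lc α y s) (fun w s => face_weight_periodic Lc β w s) μ (toSite c) ν (Sum.inl α) (Sum.inl β)


/-- [folklore] **THE `K·W·K` WORD OF THE DRESSED SOURCE IN OUTER-SUMMED FORM** (block-covariant first tables `S κ (u + Lc•t) = shiftK (−Lc•t) (S κ u)`,
`M ρ (w + t) = shiftK (−Lc•t) (M ρ w)` — an2's `SpureRecAt_translate`, an1's `M1At_translate` have this shape): with exit-face indicator weights on axes `α β` and legs `inl α, inl β`,
`Σ_{c∈box P} Σ'_{u′} FF[W2SymOfK X̃♮_j Lc S M 0 M₂ μ c ν u′] = ½·Σ_{c∈box P} (Σ'_{u′} FF[dM (K2OfK X̃♮_j … ν c) … μ u′] + Σ'_{u′} FF[dM (K2OfK X̃♮_j … μ c) … ν u′])` — BOTH remaining words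
carry the derivative of the inverse at the CELL bond and the outer background derivative at the LATTICE-SUMMED bond. -/
theorem sum_box_tsum_W_word_eq_half_outer_resp (hLc : 1 ≤ Lc) (hr : r ∈ box (d + 1) Lc) (sf sm : ℝ) (j : ℕ)
    (hS : LocStencil S Cs δs) (hδs : 0 < δs) (hM : VertexFamily M Lc CM δM) (hδM : 0 < δM) (hM₂ : LocStencilFM Lc M₂ C₂ δ₂) (hδ₂ : 0 < δ₂)
    (hM₂t : ∀ (κ : Fin (d + 1)) (u : Site (d + 1)) (ρ : Fin (d + 1)) (w t : Site (d + 1)),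
      M₂ κ (u + (Lc : ℤ) • t) ρ (w + t) = shiftK (-((Lc : ℤ) • t)) (M₂ κ u ρ w))
    (hSt : ∀ (κ : Fin (d + 1)) (u t : Site (d + 1)), S κ (u + (Lc : ℤ) • t) = shiftK (-((Lc : ℤ) • t)) (S κ u))
    (hMt : ∀ (ρ' : Fin (d + 1)) (w t : Site (d + 1)), M ρ' (w + t) = shiftK (-((Lc : ℤ) • t)) (M ρ' w))
    (P : ℕ) (μ ν α β : Fin (d + 1)) :
    (∑ c ∈ box (d + 1) P, ∑' u' : Site (d + 1), ∑' yw : Site (d + 1) × Site (d + 1),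
        (if yw.1 α % (Lc : ℤ) = (Lc : ℤ) - 1 then (1 : ℝ) else 0) * (if yw.2 β % (Lc : ℤ) = (Lc : ℤ) - 1 then (1 : ℝ) else 0) *
          W2SymOfK (unitK sf sm (coDressKBmAt (toSite r) Lc (KInvStep (d := d) Lc j))) Lc S M 0 M₂ μ (toSite c) ν u' yw.1 yw.2 (Sum.inl α) (Sum.inl β))
      = (1 / 2 : ℝ) * ∑ c ∈ box (d + 1) P,
          ((∑' u' : Site (d + 1), ∑' yw : Site (d + 1) × Site (d + 1),
              (if yw.1 α % (Lc : ℤ) = (Lc : ℤ) - 1 then (1 : ℝ) else 0) * (if yw.2 β % (Lc : ℤ) = (Lc : ℤ) - 1 then (1 : ℝ) else 0) *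
                dM (K2OfK (unitK sf sm (coDressKBmAt (toSite r) Lc (KInvStep (d := d) Lc j))) Lc S M ν (toSite c)) Lc S M μ u' yw.1 yw.2 (Sum.inl α) (Sum.inl β))
            + ∑' u' : Site (d + 1), ∑' yw : Site (d + 1) × Site (d + 1),
              (if yw.1 α % (Lc : ℤ) = (Lc : ℤ) - 1 then (1 : ℝ) else 0) * (if yw.2 β % (Lc : ℤ) = (Lc : ℤ) - 1 then (1 : ℝ) else 0) *
                dM (K2OfK (unitK sf sm (coDressKBmAt (toSite r) Lc (KInvStep (d := d) Lc j))) Lc S M μ (toSite c)) Lc S M ν u' yw.1 yw.2 (Sum.inl α) (Sum.inl β)) := by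
  rw [sum_box_tsum_W_word_eq_half_resp hLc hr sf sm j hS hδs hM hδM hM₂ hδ₂ hM₂t P μ ν α β]
  refine congrArg (fun x : ℝ => (1 / 2 : ℝ) * x) (Finset.sum_congr rfl fun c _ => ?_)
  rw [tsum_twoFace_resp_inner_eq_outer (fun t => shiftK_dressedStep (r := r) hLc sf sm j t) hSt hMt
    (ρ₁ := fun y : Site (d + 1) => (if y α % (Lc : ℤ) = (Lc : ℤ) - 1 then (1 : ℝ) else 0))
    (ρ₂ := fun w : Site (d + 1) => (if w β % (Lc : ℤ) = (Lc : ℤ) - 1 then (1 : ℝ) else 0))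
    (fun y s => face_weight_periodic Lc α y s) (fun w s => face_weight_periodic Lc β w s) μ (toSite c) ν (Sum.inl α) (Sum.inl β)]

end Dressed

end Summit.QuantumFields.BalabanUV.Beta.GAN24.WWordRespSummable

end
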